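import Summits.AtomisticToContinuum.BoseEinsteinCondensation.Theorems.BECStronglyRayleighLatticeToPeriodicBridgeCellNormRetention
import Summits.AtomisticToContinuum.BoseEinsteinCondensation.Theorems.BECStronglyRayleighLatticeToPeriodicBridgeCellPairSumRule

/-!
# Route `BECStronglyRayleigh`, crux `LatticeToPeriodicBridge` (stmt-AtomisticToContinuum-9674),
# line `coarse-cell-lorentzian` — the row-flatness SANDWICH (S45 is pair condensation in costume)

Helper file of the crux line `coarse-cell-lorentzian` (skeleton
`Summits/AtomisticToContinuum/BoseEinsteinCondensation/Cruxes/LatticeToPeriodicBridge/Lines/coarse-cell-lorentzian.lean`,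
registered open stub `Sig.stub_pairKernelRowFlatness` = S45, lead's reshape v3/v4), landed
`--supports stmt-AtomisticToContinuum-9674`.

Lead-0's composition `periodicBEC_of` shows S45 ⟹ torus BEC of the real `≥ 0` near-minimisers (with the landed S1–S3, S6).
This file proves the CONVERSE bookkeeping: S45 FOLLOWS from a pair-condensate floor that mentions no lattice, no cells
and no kernels. Two elementary inequalities for a real periodic trial state `Ψ` of `N'+2` bosons on the torus of side `L`
cut into `M³` cells of side `b = L/M`:

* `kernelMass_le_pow_six` : `I_K = ∫_{X'} Σ_{x,y} K_{X'}(x,y)² ≤ b⁶` — Cauchy–Schwarz on each cell pair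
  (`K_{X'}(x,y)² ≤ b⁶ ∫_{C_x×C_y} (Re Ψ)²`), the `M⁶` pairs tile `cell²`, and `∫_{X'}∫_{cell²}(Re Ψ)² = 1`;
* `integral_sq_pairIntegral_le_mul_fieldMass` : `∫_{X'} (∫_{cell²} Re Ψ(ξ,η,X'))² ≤ M³ · I_r` — the double cell integral is
  `Σ_x r_{X'}(x)` (tiling) and `(Σ_x r_x)² ≤ M³ Σ_x r_x²` (Cauchy–Schwarz over the `M³` rows);

whence `stub_pairKernelRowFlatness_of_pairCondensateFloor`: if every real `≥ 0` near-minimiser has pair-condensate mass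
`∫_{X'}(∫_{cell²}Re Ψ)² ≥ L⁶/𝕄` (i.e. `⟨Ψ, (P₀ ⊗ P₀ ⊗ 1) Ψ⟩ ≥ 1/𝕄`, `P₀ = |φ₀⟩⟨φ₀|` the constant mode), uniformly in
`L ≥ L₁`, `N'+2 ≤ ρ_d L³`, then `M³ I_K ≤ M³ b⁶ = L⁶/M³ ≤ 𝕄 I_r`, which is S45 with the same constant `𝕄` (and `b₁ = L₁`).
Since `⟨n̂₀²⟩ ≥ ⟨n̂₀⟩²` gives `⟨P₀⊗P₀⊗1⟩ ≥ (n₀/N)² - (n₀/N)/(N-1)`, the pair floor is ordinary torus BEC of the near-minimisers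
up to constants: the line's residual stub is SANDWICHED between two forms of the consequent — a dictionary, not a reduction.

References: O. Penrose, L. Onsager, Phys. Rev. 104 (1956) 576 (coarse-grained criteria for BEC); LSSY 2005 §1.2.
-/

noncomputable section

open MeasureTheory Filter Metric Set
open scoped ENNReal Topology NNReal Real

namespace Summit.AtomisticToContinuum.BoseEinsteinCondensation.Cruxes.LatticeToPeriodicBridge.CoarseCellLorentzian

namespace RowFlatnessSandwich

open Literature.MathematicalPhysics.QuantumManyBody.BoseGas
open Literature.MathematicalPhysics.QuantumManyBody.BoseGas.Poincare
open CellNormRetention CellPairSumRule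

/-! ## Cauchy–Schwarz on a set of finite measure (real form) -/

/-- **Cauchy–Schwarz against `1`** on a set of finite measure, real form: `(∫_s g)² ≤ μ(s) · ∫_s g²` for `g`
with `g²` integrable on `s` (via the `ℝ≥0∞` form `‖∫_s h‖₊² ≤ μ(s) ∫⁻_s ‖h‖₊²`). [folklore] -/
theorem sq_setIntegral_le_measureReal_mul {α : Type*} [MeasurableSpace α] {μ : Measure α} {s : Set α}
    (hs : μ s ≠ ∞) {g : α → ℝ} (hg : AEStronglyMeasurable g (μ.restrict s))
    (hg2 : IntegrableOn (fun a => g a ^ 2) s μ) :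
    (∫ a in s, g a ∂μ) ^ 2 ≤ μ.real s * ∫ a in s, g a ^ 2 ∂μ := by
  have h := sq_nnnorm_setIntegral_le (μ := μ) (s := s) (h := fun a => (g a : ℂ))
    (Complex.continuous_ofReal.comp_aestronglyMeasurable hg)
  rw [integral_complex_ofReal, coe_nnnorm_sq_eq_ofReal, Complex.norm_real, Real.norm_eq_abs, sq_abs] at h
  have h2 : ∫⁻ a in s, (‖(g a : ℂ)‖₊ : ℝ≥0∞) ^ 2 ∂μ = ENNReal.ofReal (∫ a in s, g a ^ 2 ∂μ) := by
    rw [ofReal_integral_eq_lintegral_ofReal hg2 (Eventually.of_forall fun a => sq_nonneg (g a))]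
    refine lintegral_congr fun a => ?_
    rw [coe_nnnorm_sq_eq_ofReal, Complex.norm_real, Real.norm_eq_abs, sq_abs]
  rw [h2, ← ENNReal.ofReal_toReal hs, ← measureReal_def,
    ← ENNReal.ofReal_mul measureReal_nonneg] at h
  exact (ENNReal.ofReal_le_ofReal_iff (mul_nonneg measureReal_nonneg
    (integral_nonneg fun a => sq_nonneg (g a)))).1 h

/-! ## One background `X'`: the two pointwise inequalities -/

section Pointwise

variable {N' M : ℕ} {L : ℝ}

/-- **Kernel entries are small means**: `K_{X'}(x,y)² ≤ b⁶ ∫_{C_x×C_y} (Re Ψ(·,·,X'))²` (Cauchy–Schwarz on the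
cell pair, `|C_x × C_y| = b⁶`). [folklore] -/
theorem cellKernel_sq_le {Ψ : Config (N' + 2) → ℂ} (hΨ : Continuous Ψ) (hL : 0 < L) (hM : 1 ≤ M)
    (X' : Config N') (x y : Fin 3 → Fin M) :
    cellKernel L M Ψ X' x y ^ 2 ≤ (L / M) ^ 6 *
      ∫ p in cubeIco (corner M (L / M) x) (L / M) ×ˢ cubeIco (corner M (L / M) y) (L / M),
        (Ψ (Fin.cons p.1 (Fin.cons p.2 X'))).re ^ 2 := by
  have hMpos : (0 : ℝ) < M := by exact_mod_cast hM
  have hb : 0 < L / M := div_pos hL hMpos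
  have hGc : Continuous fun p : Space × Space => (Ψ (Fin.cons p.1 (Fin.cons p.2 X'))).re :=
    Complex.continuous_re.comp (hΨ.comp (continuous_finCons_finCons_left X'))
  set S : Set (Space × Space) := cubeIco (corner M (L / M) x) (L / M) ×ˢ cubeIco (corner M (L / M) y) (L / M)
    with hS
  have hvol : (volume : Measure (Space × Space)).real S = (L / M) ^ 6 := volume_real_prod_cubeIco _ _ hb.le
  have hfin : (volume : Measure (Space × Space)) S ≠ ∞ := by
    intro htop
    have : (volume : Measure (Space × Space)).real S = 0 := by rw [measureReal_def, htop, ENNReal.toReal_top]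
    rw [hvol] at this
    exact absurd this (pow_pos hb 6).ne'
  rw [cellKernel_eq_setIntegral_prod hΨ L M X' x y, ← hvol]
  exact sq_setIntegral_le_measureReal_mul hfin
    (integrableOn_prod_cubeIco hGc _ _ _).aestronglyMeasurable (integrableOn_prod_cubeIco (hGc.pow 2) _ _ _)

/-- **Frobenius mass of the kernels at fixed background**: `Σ_{x,y} K_{X'}(x,y)² ≤ b⁶ ∫_{cell²} (Re Ψ(·,·,X'))²`
(sum the cell-pair bound over the `M⁶` pairs, which tile `cell²`). [folklore] -/
theorem sum_cellKernel_sq_le {Ψ : Config (N' + 2) → ℂ} (hΨ : Continuous Ψ) (hL : 0 < L) (hM : 1 ≤ M)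
    (X' : Config N') :
    ∑ x : Fin 3 → Fin M, ∑ y : Fin 3 → Fin M, cellKernel L M Ψ X' x y ^ 2 ≤
      (L / M) ^ 6 * ∫ p in cell L ×ˢ cell L, (Ψ (Fin.cons p.1 (Fin.cons p.2 X'))).re ^ 2 := by
  have hGc : Continuous fun p : Space × Space => (Ψ (Fin.cons p.1 (Fin.cons p.2 X'))).re ^ 2 :=
    (Complex.continuous_re.comp (hΨ.comp (continuous_finCons_finCons_left X'))).pow 2
  have hint : IntegrableOn (fun p : Space × Space => (Ψ (Fin.cons p.1 (Fin.cons p.2 X'))).re ^ 2)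
      (cell L ×ˢ cell L) volume := by
    rw [cell_eq_cubeIco]; exact integrableOn_prod_cubeIco hGc _ _ _
  rw [setIntegral_cell_prod_eq_sum hL hM hint, Finset.mul_sum]
  refine Finset.sum_le_sum fun x _ => ?_
  rw [Finset.mul_sum]
  exact Finset.sum_le_sum fun y _ => cellKernel_sq_le hΨ hL hM X' x y

/-- **The double cell integral is the total of the kernel**: `∫_{cell²} Re Ψ(·,·,X') = Σ_x Σ_y K_{X'}(x,y)`
(tiling). [folklore] -/
theorem setIntegral_prod_eq_sum_cellKernel {Ψ : Config (N' + 2) → ℂ} (hΨ : Continuous Ψ) (hL : 0 < L)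
    (hM : 1 ≤ M) (X' : Config N') :
    ∫ p in cell L ×ˢ cell L, (Ψ (Fin.cons p.1 (Fin.cons p.2 X'))).re =
      ∑ x : Fin 3 → Fin M, ∑ y : Fin 3 → Fin M, cellKernel L M Ψ X' x y := by
  have hGc : Continuous fun p : Space × Space => (Ψ (Fin.cons p.1 (Fin.cons p.2 X'))).re :=
    Complex.continuous_re.comp (hΨ.comp (continuous_finCons_finCons_left X'))
  have hint : IntegrableOn (fun p : Space × Space => (Ψ (Fin.cons p.1 (Fin.cons p.2 X'))).re)
      (cell L ×ˢ cell L) volume := by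
    rw [cell_eq_cubeIco]; exact integrableOn_prod_cubeIco hGc _ _ _
  rw [setIntegral_cell_prod_eq_sum hL hM hint]
  refine Finset.sum_congr rfl fun x _ => Finset.sum_congr rfl fun y _ => ?_
  rw [cellKernel_eq_setIntegral_prod hΨ L M X' x y]

/-- **Row Cauchy–Schwarz at fixed background**: `(∫_{cell²} Re Ψ(·,·,X'))² ≤ M³ · Σ_x r_{X'}(x)²`
(`Σ_x r_x = Σ_{x,y} K(x,y)` and `(Σ_x r_x)² ≤ M³ Σ_x r_x²`). [folklore] -/
theorem sq_setIntegral_prod_le_mul_sum_cellField_sq {Ψ : Config (N' + 2) → ℂ} (hΨ : Continuous Ψ)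
    (hL : 0 < L) (hM : 1 ≤ M) (X' : Config N') :
    (∫ p in cell L ×ˢ cell L, (Ψ (Fin.cons p.1 (Fin.cons p.2 X'))).re) ^ 2 ≤
      (M : ℝ) ^ 3 * ∑ x : Fin 3 → Fin M, cellField L M Ψ X' x ^ 2 := by
  rw [setIntegral_prod_eq_sum_cellKernel hΨ hL hM X']
  have h := sq_sum_le_card_mul_sum_sq (s := (Finset.univ : Finset (Fin 3 → Fin M)))
    (f := fun x => cellField L M Ψ X' x)
  simp only [Finset.card_univ, Fintype.card_fun, Fintype.card_fin] at h
  have hcard : (((M ^ 3 : ℕ)) : ℝ) = (M : ℝ) ^ 3 := by push_cast; ring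
  unfold cellField at h ⊢
  calc (∑ x : Fin 3 → Fin M, ∑ y : Fin 3 → Fin M, cellKernel L M Ψ X' x y) ^ 2
      ≤ ((M ^ 3 : ℕ) : ℝ) * ∑ x : Fin 3 → Fin M, (∑ y : Fin 3 → Fin M, cellKernel L M Ψ X' x y) ^ 2 := by
        exact_mod_cast h
    _ = (M : ℝ) ^ 3 * ∑ x : Fin 3 → Fin M, (∑ y : Fin 3 → Fin M, cellKernel L M Ψ X' x y) ^ 2 := by
        rw [hcard]

end Pointwise

/-! ## Integrating over the background -/

section Integrated

variable {N' M : ℕ} {L : ℝ}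

/-- **`I_K ≤ b⁶`**: for a REAL periodic trial state of `N'+2` bosons (normalised on the cell) and `M ≥ 1`,
`kernelMass L M Ψ ≤ (L/M)⁶`. [folklore] -/
theorem kernelMass_le_pow_six (hL : 0 < L) (hM : 1 ≤ M) (Ψ : PeriodicTrialState (N' + 2) L)
    (hreal : ∀ X, (Ψ.ψ X).im = 0) : kernelMass L M Ψ.ψ ≤ (L / M) ^ 6 := by
  have hΨc := Ψ.contDiff.continuous
  set μ2 : Measure (Space × Space) := ((volume : Measure Space).restrict (cell L)).prod
    ((volume : Measure Space).restrict (cell L)) with hμ2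
  have hμ2' : μ2 = volume.restrict (cell L ×ˢ cell L) := by
    rw [hμ2, Measure.prod_restrict, ← Measure.volume_eq_prod]
  set F : Config N' → ℝ := fun X' => ∫ p, (Ψ.ψ (Fin.cons p.1 (Fin.cons p.2 X'))).re ^ 2 ∂μ2 with hF
  set S : Config N' → ℝ := fun X' => ∑ x : Fin 3 → Fin M, ∑ y : Fin 3 → Fin M,
    cellKernel L M Ψ.ψ X' x y ^ 2 with hS
  have hFi : Integrable F ((volume : Measure (Config N')).restrict (cellN N' L)) :=
    integrableOn_integral_pair (h := fun X => (Ψ.ψ X).re ^ 2) ((Complex.continuous_re.comp hΨc).pow 2) L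
  have hSc : Continuous S := by
    refine continuous_finsetSum _ fun x _ => continuous_finsetSum _ fun y _ => ?_
    exact (continuous_cellKernel hΨc L M x y).pow 2
  have hSi : Integrable S ((volume : Measure (Config N')).restrict (cellN N' L)) := integrableOn_cellN hSc L
  have hpt : ∀ X', S X' ≤ (L / M) ^ 6 * F X' := fun X' => by
    simp only [hS, hF, hμ2']
    exact sum_cellKernel_sq_le hΨc hL hM X'
  have hint : ∫ X' in cellN N' L, S X' ≤ ∫ X' in cellN N' L, (L / M) ^ 6 * F X' :=
    integral_mono hSi (hFi.const_mul _) hpt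
  rw [integral_const_mul] at hint
  have h1 : ∫ X' in cellN N' L, F X' = 1 := integral_integral_re_sq_eq_one Ψ hreal
  have hKM : kernelMass L M Ψ.ψ = ∫ X' in cellN N' L, S X' := rfl
  rw [hKM]
  simpa [h1] using hint

/-- **Pair-condensate mass is at most `M³ · I_r`**: for a periodic trial state of `N'+2` bosons and `M ≥ 1`,
`∫_{X' ∈ cell^{N'}} (∫_{cell²} Re Ψ(ξ,η,X'))² ≤ M³ · fieldMass L M Ψ`. [folklore] -/
theorem integral_sq_pairIntegral_le_mul_fieldMass (hL : 0 < L) (hM : 1 ≤ M)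
    (Ψ : PeriodicTrialState (N' + 2) L) :
    ∫ X' in cellN N' L, (∫ p in cell L ×ˢ cell L, (Ψ.ψ (Fin.cons p.1 (Fin.cons p.2 X'))).re) ^ 2 ≤
      (M : ℝ) ^ 3 * fieldMass L M Ψ.ψ := by
  have hΨc := Ψ.contDiff.continuous
  set P : Config N' → ℝ := fun X' =>
    (∫ p in cell L ×ˢ cell L, (Ψ.ψ (Fin.cons p.1 (Fin.cons p.2 X'))).re) ^ 2 with hP
  set R : Config N' → ℝ := fun X' => ∑ x : Fin 3 → Fin M, cellField L M Ψ.ψ X' x ^ 2 with hR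
  have hPeq : P = fun X' => (∑ x : Fin 3 → Fin M, ∑ y : Fin 3 → Fin M, cellKernel L M Ψ.ψ X' x y) ^ 2 := by
    funext X'
    simp only [hP, setIntegral_prod_eq_sum_cellKernel hΨc hL hM X']
  have hPc : Continuous P := by
    rw [hPeq]
    refine Continuous.pow (continuous_finsetSum _ fun x _ => continuous_finsetSum _ fun y _ => ?_) 2
    exact continuous_cellKernel hΨc L M x y
  have hRc : Continuous R := by
    refine continuous_finsetSum _ fun x _ => Continuous.pow ?_ 2
    unfold cellField
    exact continuous_finsetSum _ fun y _ => continuous_cellKernel hΨc L M x y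
  have hPi : Integrable P ((volume : Measure (Config N')).restrict (cellN N' L)) := integrableOn_cellN hPc L
  have hRi : Integrable R ((volume : Measure (Config N')).restrict (cellN N' L)) := integrableOn_cellN hRc L
  have hpt : ∀ X', P X' ≤ (M : ℝ) ^ 3 * R X' := fun X' =>
    sq_setIntegral_prod_le_mul_sum_cellField_sq hΨc hL hM X'
  have hint : ∫ X' in cellN N' L, P X' ≤ ∫ X' in cellN N' L, (M : ℝ) ^ 3 * R X' :=
    integral_mono hPi (hRi.const_mul _) hpt
  rw [integral_const_mul] at hint
  exact hint

end Integrated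

end RowFlatnessSandwich

/-! ## The sandwich: S45 from a pair-condensate floor -/

open Literature.MathematicalPhysics.QuantumManyBody.BoseGas RowFlatnessSandwich in
/-- **Row flatness from pair condensation** (the converse bookkeeping of the line): if for every repulsive
finite-range `v` there are `𝕄, L₁, ρ_d > 0` such that on every torus of side `L ≥ L₁` with `N'+2 ≤ ρ_d L³` bosons some
slack `δ > 0` makes every REAL NON-NEGATIVE `δ`-near-minimiser carry pair-condensate mass
`∫_{X'}(∫_{cell²} Re Ψ(ξ,η,X'))² ≥ L⁶/𝕄` (i.e. `⟨Ψ,(P₀⊗P₀⊗1)Ψ⟩ ≥ 1/𝕄` for the constant mode `φ₀ = L^{-3/2}`), then the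
registered stub `Sig.stub_pairKernelRowFlatness` holds with the same `𝕄` (and `b₁ = L₁`): for `M ≥ 2` cells per side of
side `b = L/M ≥ L₁`, `M³·I_K ≤ M³b⁶ = L⁶/M³ ≤ 𝕄·I_r` by `kernelMass_le_pow_six` and
`integral_sq_pairIntegral_le_mul_fieldMass`. No lattice input, no signature, no Poincaré inequality is used: the
residual stub of the line is implied by (pair) torus BEC of the near-minimisers alone. [folklore] -/
theorem stub_pairKernelRowFlatness_of_pairCondensateFloor
    (h : ∀ v : ℝ → ℝ≥0∞, IsRepulsiveFiniteRange v → ∃ 𝕄 : ℝ, 0 < 𝕄 ∧ ∃ L₁ : ℝ, 0 < L₁ ∧ ∃ ρd : ℝ, 0 < ρd ∧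
      ∀ L : ℝ, L₁ ≤ L → ∀ N' : ℕ, ((N' : ℝ) + 2) ≤ ρd * L ^ 3 →
        ∃ δ : ℝ≥0∞, 0 < δ ∧ ∀ Ψ : PeriodicTrialState (N' + 2) L,
          (∀ X, 0 ≤ (Ψ.ψ X).re ∧ (Ψ.ψ X).im = 0) →
          periodicEnergy v Ψ ≤ periodicGroundStateEnergy v (N' + 2) L + δ →
            L ^ 6 ≤ 𝕄 * ∫ X' in cellN N' L,
              (∫ p in cell L ×ˢ cell L, (Ψ.ψ (Fin.cons p.1 (Fin.cons p.2 X'))).re) ^ 2) :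
    Sig.stub_pairKernelRowFlatness := by
  intro v hv
  obtain ⟨𝕄, h𝕄, L₁, hL₁, ρd, hρd, hfloor⟩ := h v hv
  refine ⟨𝕄, h𝕄, L₁, hL₁, ρd, hρd, fun L M hL hM hb N' hN' => ?_⟩
  have hM1 : 1 ≤ M := le_trans (by norm_num) hM
  have hMpos : (0 : ℝ) < M := by exact_mod_cast (lt_of_lt_of_le Nat.zero_lt_one hM1)
  have hM2 : (2 : ℝ) ≤ M := by exact_mod_cast hM
  -- `L ≥ M·L₁ ≥ 2L₁ ≥ L₁`
  have hLL₁ : L₁ ≤ L := by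
    have h1 : L₁ * M ≤ L := by rwa [le_div_iff₀ hMpos] at hb
    nlinarith
  obtain ⟨δ, hδ, hΨfloor⟩ := hfloor L hLL₁ N' hN'
  refine ⟨δ, hδ, fun Ψ hpos hE => ?_⟩
  have hreal : ∀ X, (Ψ.ψ X).im = 0 := fun X => (hpos X).2
  have hK := kernelMass_le_pow_six hL hM1 Ψ hreal
  have hP := integral_sq_pairIntegral_le_mul_fieldMass hL hM1 Ψ
  have hfl := hΨfloor Ψ hpos hE
  have hM3 : (0 : ℝ) < (M : ℝ) ^ 3 := by positivity
  -- `M³ I_K ≤ M³ b⁶ = L⁶ / M³ ≤ 𝕄 P / M³ ≤ 𝕄 I_r`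
  have h1 : (M : ℝ) ^ 3 * kernelMass L M Ψ.ψ ≤ (M : ℝ) ^ 3 * (L / M) ^ 6 :=
    mul_le_mul_of_nonneg_left hK hM3.le
  have h2 : (M : ℝ) ^ 3 * (L / M) ^ 6 * (M : ℝ) ^ 3 = L ^ 6 := by
    field_simp
  have h3 : L ^ 6 ≤ 𝕄 * ((M : ℝ) ^ 3 * fieldMass L M Ψ.ψ) :=
    hfl.trans (mul_le_mul_of_nonneg_left hP h𝕄.le)
  have h4' : (M : ℝ) ^ 3 * (L / M) ^ 6 * (M : ℝ) ^ 3 ≤ 𝕄 * fieldMass L M Ψ.ψ * (M : ℝ) ^ 3 := by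
    rw [h2]
    calc L ^ 6 ≤ 𝕄 * ((M : ℝ) ^ 3 * fieldMass L M Ψ.ψ) := h3
      _ = 𝕄 * fieldMass L M Ψ.ψ * (M : ℝ) ^ 3 := by ring
  have h4 : (M : ℝ) ^ 3 * (L / M) ^ 6 ≤ 𝕄 * fieldMass L M Ψ.ψ := le_of_mul_le_mul_right h4' hM3
  exact h1.trans h4

/-- **Registered form of the sandwich** (sub-goal `rowFlatnessSandwich_pairFloor` of the crux item, signature verbatim, fully
qualified): a pair-condensate floor for the real `≥ 0` near-minimisers implies the registered stub
`Sig.stub_pairKernelRowFlatness` (= `stub_pairKernelRowFlatness_of_pairCondensateFloor`). [folklore] -/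
theorem rowFlatnessSandwich_pairFloor : (∀ v : ℝ → ENNReal, Literature.MathematicalPhysics.QuantumManyBody.BoseGas.IsRepulsiveFiniteRange v → ∃ 𝕄 : ℝ, 0 < 𝕄 ∧ ∃ L₁ : ℝ, 0 < L₁ ∧ ∃ ρd : ℝ, 0 < ρd ∧ ∀ L : ℝ, L₁ ≤ L → ∀ N' : ℕ, ((N' : ℝ) + 2) ≤ ρd * L ^ 3 → ∃ δ : ENNReal, 0 < δ ∧ ∀ Ψ : Literature.MathematicalPhysics.QuantumManyBody.BoseGas.PeriodicTrialState (N' + 2) L, (∀ X, 0 ≤ (Ψ.ψ X).re ∧ (Ψ.ψ X).im = 0) → Literature.MathematicalPhysics.QuantumManyBody.BoseGas.periodicEnergy v Ψ ≤ Literature.MathematicalPhysics.QuantumManyBody.BoseGas.periodicGroundStateEnergy v (N' + 2) L + δ → L ^ 6 ≤ 𝕄 * MeasureTheory.integral (MeasureTheory.Measure.restrict MeasureTheory.volume (Literature.MathematicalPhysics.QuantumManyBody.BoseGas.cellN N' L)) (fun X' => (MeasureTheory.integral (MeasureTheory.Measure.restrict MeasureTheory.volume (Literature.MathematicalPhysics.QuantumManyBody.BoseGas.cell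 L ×ˢ Literature.MathematicalPhysics.QuantumManyBody.BoseGas.cell L)) (fun p => (Ψ.ψ (Fin.cons p.1 (Fin.cons p.2 X'))).re)) ^ 2)) → Sig.stub_pairKernelRowFlatness :=
  fun h => stub_pairKernelRowFlatness_of_pairCondensateFloor h

end Summit.AtomisticToContinuum.BoseEinsteinCondensation.Cruxes.LatticeToPeriodicBridge.CoarseCellLorentzian

end
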